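import Mathlib
import HarnessLib
import Summits.Ventures.LatticeQCDFlow.Scoring.SelfNormalisedReweightingConsistency

/-!
# The ERROR-BAR column at `ε = 0`: the printed squared standard error of the self-normalised
# reweighting estimate, `V̂ₙ = Σ w̃ᵢ²(Oᵢ − Sₙ)²/(Σ w̃ᵢ)²`, satisfies
# `n·V̂ₙ → ∫ (p²/q)(O − E_p O)² dμ` almost surely — the delta-method (sandwich) variance — along
# one growing proposal stream

HONEST FRAMING: exact (Metropolis-corrected) sampling algorithms for lattice gauge theory;
figures of merit are autocorrelation/cost numbers at stated couplings and volumes; no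
continuum-physics claim.

Venture `LatticeQCDFlow` (cell pub-lqcd), topic `Scoring`; FANOUT row 4 (`s0-u1-b`, rung S0-B:
two codes compared column by column, 'within `1σ_comb`' for the observable columns).  Sequel of
`Scoring/SelfNormalisedReweightingConsistency` (imported: the strong law along a stream, `W̄ₙ → 1`,
`F̄ₙ → M₂`, `Sₙ → E_p O`).  Next to its self-normalised estimate
`Sₙ = Σ_{i<n} w̃ᵢO(yᵢ)/Σ_{i<n} w̃ᵢ` a flow code prints the standard error whose square is the
textbook delta-method formula `V̂ₙ = Σ_{i<n} w̃ᵢ²(O(yᵢ) − Sₙ)² / (Σ_{i<n} w̃ᵢ)²` (Owen, *Monte Carlo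
theory, methods and examples* (2013) §9.2, eq. (9.8); Hesterberg, Technometrics 37 (1995) — NAMED
ONLY), scale-free in the normalisation `w̃ = c·w`.  This file is the `ε = 0` rung for that
column: with `M₂ = ∫ p²/q dμ`, `T₁ = ∫ (p²/q)·O dμ`, `T₂ = ∫ (p²/q)·O² dμ` finite and
`p·O ∈ L¹(μ)`, almost surely `n·V̂ₙ → T₂ − 2aT₁ + a²M₂ = ∫ (p²/q)(O − a)² dμ`, `a = E_p O` — the
asymptotic (sandwich) variance `σ²_SN = E_q[w²(O − a)²]` of self-normalised importance sampling; so
`V̂ₙ ≈ σ²_SN/n` is a consistent error bar and two codes' printed error bars are consistent for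
their OWN `σ²_SN(q_A)`, `σ²_SN(q_B)`.  Inputs are second weight moments against `O` (this column
IS a second-moment object); nothing is cited as a fact; NEW WORK of the cell (elementary); no
definition is introduced.

## Content (`ν = μ.withDensity q`; `w = p/q`; `a = ∫ p·O dμ`; stream `y : ℕ → Ω → X` independent
## with laws `ν`)

* dictionary: `integrable_sqWeightMul_model_iff` (`w²g ∈ L¹(ν) ↔ (p²/q)g ∈ L¹(μ)`),
  `integral_sqWeightMul_model` (`E_ν w²g = ∫ (p²/q)g dμ`), `sqWeightMulMean_tendsto_ae`
  (`Σ_{i<n} w(yᵢ)²g(yᵢ)/n → ∫ (p²/q)g dμ` a.s.);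
* `integral_sandwichVariance_eq` (`∫ (p²/q)(O − a)² = T₂ − 2aT₁ + a²M₂`);
* `errorBar_eq_of_sum_ne_zero` (the printed `n·V̂ₙ`, any `c ≠ 0`, as a rational function of the
  five normalised running means);
* **`selfNormErrorBar_tendsto_ae`** — `n·V̂ₙ → ∫ (p²/q)(O − ∫ p·O dμ)² dμ` almost surely.

NOT CLAIMED: that `√V̂ₙ` is a valid confidence radius at finite `n` (a CLT / Berry–Esseen
statement — not here; row 4's median-of-blocks files are the finite-`n` certificates); the
ESS-based error bar; the chain-side (`τ_int`) error bar; any number of ours re-scored.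
-/

noncomputable section

namespace Summit.Ventures.LatticeQCDFlow.Scoring.CardConsistency

open MeasureTheory ProbabilityTheory Finset Real Filter
open scoped Topology Function

section Model

variable {Ω : Type*} [MeasurableSpace Ω] {P : Measure Ω}
variable {X : Type*} [MeasurableSpace X] {μ : Measure X} {p q O g : X → ℝ} {y : ℕ → Ω → X}

/-- `w²·g ∈ L¹(q dμ) ↔ (p²/q)·g ∈ L¹(μ)` (`(p/q)²·g·q = (p²/q)·g`). [ours] -/
theorem integrable_sqWeightMul_model_iff (hpm : Measurable p) (hq0 : ∀ z, 0 < q z)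
    (hqm : Measurable q) :
    Integrable (fun a => (p a / q a) ^ 2 * g a) (μ.withDensity fun z => ENNReal.ofReal (q z))
      ↔ Integrable (fun z => p z ^ 2 / q z * g z) μ := by
  rw [AllPairsVariance.integrable_withDensity_iff' (fun z => (hq0 z).le) hqm]
  have e : (fun a => (p a / q a) ^ 2 * g a * q a) = fun a => p a ^ 2 / q a * g a := by
    funext a
    field_simp [(hq0 a).ne']
  have _ := hpm
  rw [e]

/-- `E_ν w²·g = ∫ (p²/q)·g dμ`. [ours] -/
theorem integral_sqWeightMul_model (hq0 : ∀ z, 0 < q z) (hqm : Measurable q) :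
    ∫ a, (p a / q a) ^ 2 * g a ∂(μ.withDensity fun z => ENNReal.ofReal (q z))
      = ∫ z, p z ^ 2 / q z * g z ∂μ := by
  rw [AllPairsVariance.integral_withDensity_eq' (fun z => (hq0 z).le) hqm]
  refine integral_congr_ae (Filter.Eventually.of_forall fun a => ?_)
  show (p a / q a) ^ 2 * g a * q a = p a ^ 2 / q a * g a
  field_simp [(hq0 a).ne']

/-- **Running means of `w²·g` are strongly consistent**: `(p²/q)·g ∈ L¹(μ)`, `g` measurable ⇒
`Σ_{i<n} w(yᵢ)²g(yᵢ)/n → ∫ (p²/q)·g dμ` almost surely. [ours] -/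
theorem sqWeightMulMean_tendsto_ae (hym : ∀ j, Measurable (y j)) (hind : iIndepFun y P)
    (hlaw : ∀ j, Measure.map (y j) P = μ.withDensity fun z => ENNReal.ofReal (q z))
    (hpm : Measurable p) (hq0 : ∀ z, 0 < q z) (hqm : Measurable q) (hgm : Measurable g)
    (hgi : Integrable (fun z => p z ^ 2 / q z * g z) μ) :
    ∀ᵐ ω ∂P, Tendsto (fun n : ℕ => (∑ i ∈ range n, (p (y i ω) / q (y i ω)) ^ 2 * g (y i ω)) / n)
      atTop (𝓝 (∫ z, p z ^ 2 / q z * g z ∂μ)) := by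
  have hfm : Measurable fun a => (p a / q a) ^ 2 * g a := ((hpm.div hqm).pow_const 2).mul hgm
  have h := strong_law_stream hym hind hlaw (g := fun a => (p a / q a) ^ 2 * g a) hfm
    ((integrable_sqWeightMul_model_iff hpm hq0 hqm).2 hgi)
  rw [integral_sqWeightMul_model hq0 hqm] at h
  exact h

/-- **The sandwich variance expanded**: with `M₂ = ∫ p²/q`, `T₁ = ∫ (p²/q)O`, `T₂ = ∫ (p²/q)O²`
all finite, `∫ (p²/q)(O − a)² dμ = T₂ − 2aT₁ + a²M₂`. [ours] -/
theorem integral_sandwichVariance_eq (hM2i : Integrable (fun z => p z ^ 2 / q z) μ)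
    (hT1i : Integrable (fun z => p z ^ 2 / q z * O z) μ)
    (hT2i : Integrable (fun z => p z ^ 2 / q z * O z ^ 2) μ) (a : ℝ) :
    ∫ z, p z ^ 2 / q z * (O z - a) ^ 2 ∂μ
      = (∫ z, p z ^ 2 / q z * O z ^ 2 ∂μ) - 2 * a * (∫ z, p z ^ 2 / q z * O z ∂μ)
        + a ^ 2 * ∫ z, p z ^ 2 / q z ∂μ := by
  have e : (fun z => p z ^ 2 / q z * (O z - a) ^ 2)
      = fun z => (p z ^ 2 / q z * O z ^ 2 - 2 * a * (p z ^ 2 / q z * O z))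
        + a ^ 2 * (p z ^ 2 / q z) := by
    funext z
    ring
  have h1 : Integrable (fun z => 2 * a * (p z ^ 2 / q z * O z)) μ := hT1i.const_mul _
  have h2 : Integrable (fun z => a ^ 2 * (p z ^ 2 / q z)) μ := hM2i.const_mul _
  have h3 : Integrable (fun z => p z ^ 2 / q z * O z ^ 2 - 2 * a * (p z ^ 2 / q z * O z)) μ :=
    hT2i.sub h1
  rw [e, integral_add h3 h2, integral_sub hT2i h1, integral_const_mul, integral_const_mul]

omit [MeasurableSpace X] in
/-- **The printed `n·V̂ₙ` as a rational function of five normalised running means** (weights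
printed as `w̃ = c·w`, `c ≠ 0`; valid whenever `n ≠ 0` and `Σ_{i<n} w(yᵢ) ≠ 0`). [ours] -/
theorem errorBar_eq_of_sum_ne_zero {wt : X → ℝ} {c : ℝ} (hc : c ≠ 0)
    (hwt : ∀ z, wt z = c * (p z / q z)) (v : ℕ → X) {n : ℕ} (hn : (n : ℝ) ≠ 0)
    (hA : ∑ i ∈ range n, p (v i) / q (v i) ≠ 0) :
    (n : ℝ) * ((∑ i ∈ range n, wt (v i) ^ 2 * (O (v i)
        - (∑ j ∈ range n, wt (v j) * O (v j)) / (∑ j ∈ range n, wt (v j))) ^ 2)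
        / (∑ i ∈ range n, wt (v i)) ^ 2)
      = ((∑ i ∈ range n, (p (v i) / q (v i)) ^ 2 * O (v i) ^ 2) / n
          - 2 * ((∑ j ∈ range n, p (v j) / q (v j) * O (v j)) / (∑ j ∈ range n, p (v j) / q (v j)))
            * ((∑ i ∈ range n, (p (v i) / q (v i)) ^ 2 * O (v i)) / n)
          + ((∑ j ∈ range n, p (v j) / q (v j) * O (v j)) / (∑ j ∈ range n, p (v j) / q (v j))) ^ 2
            * ((∑ i ∈ range n, (p (v i) / q (v i)) ^ 2) / n))
        / ((∑ i ∈ range n, p (v i) / q (v i)) / n) ^ 2 := by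
  -- the printed pieces in terms of the normalised weights
  have e1 : ∑ j ∈ range n, wt (v j) * O (v j) = c * ∑ j ∈ range n, p (v j) / q (v j) * O (v j) := by
    rw [Finset.mul_sum]
    exact Finset.sum_congr rfl fun j _ => by rw [hwt, mul_assoc]
  have e2 : ∑ j ∈ range n, wt (v j) = c * ∑ j ∈ range n, p (v j) / q (v j) := by
    rw [Finset.mul_sum]
    exact Finset.sum_congr rfl fun j _ => hwt _
  have eS : (∑ j ∈ range n, wt (v j) * O (v j)) / (∑ j ∈ range n, wt (v j))
      = (∑ j ∈ range n, p (v j) / q (v j) * O (v j)) / (∑ j ∈ range n, p (v j) / q (v j)) := by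
    rw [e1, e2, mul_div_mul_left _ _ hc]
  set S : ℝ := (∑ j ∈ range n, p (v j) / q (v j) * O (v j)) / (∑ j ∈ range n, p (v j) / q (v j))
    with hS
  have e3 : ∑ i ∈ range n, wt (v i) ^ 2 * (O (v i) - S) ^ 2
      = c ^ 2 * ∑ i ∈ range n, (p (v i) / q (v i)) ^ 2 * O (v i) ^ 2
        - 2 * S * c ^ 2 * ∑ i ∈ range n, (p (v i) / q (v i)) ^ 2 * O (v i)
        + S ^ 2 * c ^ 2 * ∑ i ∈ range n, (p (v i) / q (v i)) ^ 2 := by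
    rw [Finset.mul_sum, Finset.mul_sum, Finset.mul_sum, ← Finset.sum_sub_distrib,
      ← Finset.sum_add_distrib]
    refine Finset.sum_congr rfl fun i _ => ?_
    rw [hwt]
    ring
  rw [eS, e3, e2, mul_pow]
  field_simp

/-- **THE PRINTED ERROR BAR IS STRONGLY CONSISTENT FOR THE SANDWICH VARIANCE.**  One independent
proposal stream `yᵢ` (laws `μ.withDensity q`); `p` measurable, integrable, `∫ p dμ = 1`; `q > 0`
measurable; `O` measurable with `p·O`, `p²/q`, `(p²/q)·O`, `(p²/q)·O² ∈ L¹(μ)`; weights printed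
with ANY normalisation `w̃ = c·p/q`, `c ≠ 0`.  With `Sₙ = Σ_{i<n} w̃ᵢOᵢ/Σ_{i<n} w̃ᵢ` and the printed
squared standard error `V̂ₙ = Σ_{i<n} w̃ᵢ²(Oᵢ − Sₙ)²/(Σ_{i<n} w̃ᵢ)²`, almost surely
`n·V̂ₙ → ∫ (p²/q)(O − ∫ p·O dμ)² dμ` (`= E_q[w²(O − E_p O)²]`, the delta-method variance of
self-normalised importance sampling). [ours] -/
theorem selfNormErrorBar_tendsto_ae (hym : ∀ j, Measurable (y j)) (hind : iIndepFun y P)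
    (hlaw : ∀ j, Measure.map (y j) P = μ.withDensity fun z => ENNReal.ofReal (q z))
    (hpm : Measurable p) (hpi : Integrable p μ) (hp1 : ∫ z, p z ∂μ = 1) (hq0 : ∀ z, 0 < q z)
    (hqm : Measurable q) (hOm : Measurable O) (hpO : Integrable (fun z => p z * O z) μ)
    (hM2i : Integrable (fun z => p z ^ 2 / q z) μ)
    (hT1i : Integrable (fun z => p z ^ 2 / q z * O z) μ)
    (hT2i : Integrable (fun z => p z ^ 2 / q z * O z ^ 2) μ) {wt : X → ℝ} {c : ℝ} (hc : c ≠ 0)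
    (hwt : ∀ z, wt z = c * (p z / q z)) :
    ∀ᵐ ω ∂P, Tendsto (fun n : ℕ =>
        (n : ℝ) * ((∑ i ∈ range n, wt (y i ω) ^ 2 * (O (y i ω)
            - (∑ j ∈ range n, wt (y j ω) * O (y j ω)) / (∑ j ∈ range n, wt (y j ω))) ^ 2)
          / (∑ i ∈ range n, wt (y i ω)) ^ 2))
      atTop (𝓝 (∫ z, p z ^ 2 / q z * (O z - ∫ x, p x * O x ∂μ) ^ 2 ∂μ)) := by
  -- the five running means and the self-normalised estimate (normalised weights) converge a.s.
  have hS1 := selfNormReweighting_tendsto_ae hym hind hlaw hpm hpi hp1 hq0 hqm hOm hpO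
    (wt := fun z => p z / q z) (c := 1) one_ne_zero (fun z => (one_mul _).symm)
  have hM2 : ∀ᵐ ω ∂P, Tendsto (fun n : ℕ => (∑ i ∈ range n, (p (y i ω) / q (y i ω)) ^ 2) / n)
      atTop (𝓝 (∫ z, p z ^ 2 / q z ∂μ)) :=
    sqWeightMean_tendsto_ae hym hind hlaw hpm hq0 hqm hM2i
  have hT1 := sqWeightMulMean_tendsto_ae hym hind hlaw hpm hq0 hqm hOm hT1i
  have hT2 := sqWeightMulMean_tendsto_ae hym hind hlaw hpm hq0 hqm (hOm.pow_const 2)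
    (g := fun z => O z ^ 2) hT2i
  filter_upwards [meanWeight_tendsto_one_ae hym hind hlaw hpm hpi hp1 hq0 hqm, hS1, hM2, hT1, hT2]
    with ω hW hS hF hB1 hB2
  -- the limit of the rational function of the running means
  have hlim : Tendsto (fun n : ℕ =>
      ((∑ i ∈ range n, (p (y i ω) / q (y i ω)) ^ 2 * O (y i ω) ^ 2) / n
        - 2 * ((∑ j ∈ range n, p (y j ω) / q (y j ω) * O (y j ω))
            / (∑ j ∈ range n, p (y j ω) / q (y j ω)))
          * ((∑ i ∈ range n, (p (y i ω) / q (y i ω)) ^ 2 * O (y i ω)) / n)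
        + ((∑ j ∈ range n, p (y j ω) / q (y j ω) * O (y j ω))
            / (∑ j ∈ range n, p (y j ω) / q (y j ω))) ^ 2
          * ((∑ i ∈ range n, (p (y i ω) / q (y i ω)) ^ 2) / n))
      / ((∑ i ∈ range n, p (y i ω) / q (y i ω)) / n) ^ 2) atTop
      (𝓝 (∫ z, p z ^ 2 / q z * (O z - ∫ x, p x * O x ∂μ) ^ 2 ∂μ)) := by
    have h := ((hB2.sub (((hS.const_mul 2).mul hB1))).add ((hS.pow 2).mul hF)).div (hW.pow 2)
      (by norm_num)
    have hL : ((∫ z, p z ^ 2 / q z * O z ^ 2 ∂μ)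
          - 2 * (∫ x, p x * O x ∂μ) * (∫ z, p z ^ 2 / q z * O z ∂μ)
          + (∫ x, p x * O x ∂μ) ^ 2 * (∫ z, p z ^ 2 / q z ∂μ)) / (1 : ℝ) ^ 2
        = ∫ z, p z ^ 2 / q z * (O z - ∫ x, p x * O x ∂μ) ^ 2 ∂μ := by
      rw [one_pow, div_one, integral_sandwichVariance_eq hM2i hT1i hT2i]
    rw [← hL]
    exact h.congr' (Eventually.of_forall fun n => by rw [Pi.div_apply])
  -- the printed `n·V̂ₙ` agrees with that rational function once `Σ w ≠ 0`
  -- (eventually, as `W̄ₙ → 1`)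
  refine hlim.congr' ?_
  have hpos : ∀ᶠ n : ℕ in atTop, (1 : ℝ) / 2 < (∑ i ∈ range n, p (y i ω) / q (y i ω)) / n :=
    hW.eventually_const_lt (by norm_num)
  filter_upwards [hpos, eventually_ge_atTop 1] with n hn hn1
  have hn0 : (n : ℝ) ≠ 0 := by exact_mod_cast (show n ≠ 0 by omega)
  have hA : ∑ i ∈ range n, p (y i ω) / q (y i ω) ≠ 0 := by
    intro h0
    rw [h0, zero_div] at hn
    linarith
  exact (errorBar_eq_of_sum_ne_zero hc hwt (fun i => y i ω) hn0 hA).symm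

end Model

end Summit.Ventures.LatticeQCDFlow.Scoring.CardConsistency

end
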